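import Literature.NumberTheory.DiophantineGeometry.PlaneCurvePointIdeal
import HarnessLib

/-!
# Sections of bounded degree on an affine plane curve vanishing to high order at finitely many
# smooth points: the jet bound at a smooth point, the Hilbert-function count, existence

Topic `Literature/NumberTheory/DiophantineGeometry`. Sources: E. Kunz, *Introduction to Plane Algebraic
Curves* (Birkhäuser 2005) [Kunz2005PlaneAlgebraicCurves]: Ch. 6, Regularity Criterion 6.11 (at a regular
point the maximal ideal of `𝒪_{F,P}` is principal: "`η = r·ξ`"), App. A, Example A.10 (number of
monomials), Lemma A.11 / Example A.12 (a) (Hilbert function of `K[X]/(F)`). Use: the linear-algebra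
input of the "heights on the plane curve" step of [GenEll] Thm. 2.1 (S. Mochizuki, Math. J. Okayama
Univ. 52 (2010), pp. 12–13: `ht_E ≲ (deg E/deg ω_X + δ)·ht_{ω_X}`, obtained for a smooth plane curve of
degree `e` from polynomials of degree `≤ m` vanishing to order `≥ k` at the points of `E`, `m/k → |E|/e`).
No `def` is declared. For a field `K`, `A = K[X₀, X₁]`, `f ∈ A` of total degree `e`, a `K`-point `P`
with `𝔪_P = ker (eval P)` (`PlaneCurvePointIdeal.lean`), and `k, m : ℕ`:

* **Jet bound at a smooth point** (`finrank_quotient_span_sup_pow_le`): `f(P) = 0`, `∂_w f(P) ≠ 0`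
  ⟹ `dim_K A/((f) + 𝔪_P^k) ≤ k` ("vanishing to order `≥ k` along the curve at `P`", i.e.
  `g ∈ (f) + 𝔪_P^k`, is at most `k` linear conditions); mechanism over any commutative ring with
  `∂_w f(P)` a unit: `X_w − P_w ≡ −∂_u f(P)/∂_w f(P)·(X_u − P_u)` mod `(f) + 𝔪_P²`
  (`pow_mul_X_sub_C_mem`), `𝔪_P^j ⊆ ((X_u − P_u)^j) + (f) + 𝔪_P^{j+1}` (`ker_pow_le_span_pow_sup`),
  `A = Σ_{i<k} R·(X_u − P_u)^i + ((f) + 𝔪_P^k)` (`top_le_span_pow_sup`).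
* **Hilbert-function count**: `dim_K K[X_σ]_{≤s} = C(s+|σ|, |σ|)` (`finrank_restrictTotalDegree_eq_choose`),
  `dim_K A_{≤m} = C(m+2, 2)`, `dim_K (A_{≤m} ∩ (f)) ≤ C(m+2−e, 2)` (`finrank_restrictTotalDegree_inf_span_le`)
  — so `dim A_{≤m}/(f)_{≤m} ≥ e·m − g + 1`, `g = (e−1)(e−2)/2`, for `m ≥ e − 2`.
* **Existence** (`exists_totalDegree_le_notMem_span`, `…'`): for a finite set `Δ` of smooth `K`-points
  of `f = 0` with `k·|Δ| + C(m+2−e, 2) < C(m+2, 2)` there is `g` with `deg g ≤ m`, `g ∉ (f)`, and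
  `g ∈ (f) + 𝔪_P^k` for all `P ∈ Δ` (rank–nullity).

Not here: heights/conductors, the choice of `m, k`, and the equality `dim A/((f) + 𝔪_P^k) = k`.
-/

noncomputable section

open MvPolynomial Module

namespace Literature.NumberTheory.DiophantineGeometry.PlaneCurve

/-! ## The jet bound at a smooth point of a plane curve -/

section Jet

variable {R : Type*} [CommRing R]

/-- **The key congruence at a smooth point.** If `f(P) = 0` and `∂_w f(P)` is a unit, then for
`u ≠ w` and every `a`: `(X_u − P_u)^a (X_w − P_w) ∈ ((X_u − P_u)^{a+1}) + (f) + 𝔪_P^{a+2}` — from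
the first-order Taylor expansion `f = ∂_u f(P)(X_u − P_u) + ∂_w f(P)(X_w − P_w) + (𝔪_P²)`; this is the
printed step "`f = φ_1·X − φ_2·Y`, `φ_2(0,0) ≠ 0` … we get an equation `η = r·ξ`" at a regular point.
[cite: Kunz2005PlaneAlgebraicCurves, Ch. 6 Regularity Criterion 6.11 (proof of (a) ⇒ (b))] -/
theorem pow_mul_X_sub_C_mem {u w : Fin 2} (huw : u ≠ w) {P : Fin 2 → R}
    {f : MvPolynomial (Fin 2) R} (hf : eval P f = 0) (hw : IsUnit (eval P (pderiv w f))) (a : ℕ) :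
    (X u - C (P u) : MvPolynomial (Fin 2) R) ^ a * (X w - C (P w)) ∈
      Ideal.span {(X u - C (P u) : MvPolynomial (Fin 2) R) ^ (a + 1)} ⊔
        (Ideal.span {f} ⊔ RingHom.ker (eval P : MvPolynomial (Fin 2) R →+* R) ^ (a + 2)) := by
  classical
  set yu : MvPolynomial (Fin 2) R := X u - C (P u) with hyu
  set yw : MvPolynomial (Fin 2) R := X w - C (P w) with hyw
  set α : R := eval P (pderiv u f) with hα
  set β : R := eval P (pderiv w f) with hβ
  set m := RingHom.ker (eval P : MvPolynomial (Fin 2) R →+* R) with hm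
  -- Taylor: `r := f - α yu - β yw ∈ m²`
  have hr : f - C α * yu - C β * yw ∈ m ^ 2 := by
    have h := taylor_remainder_mem_sq_fin_two huw P f
    rw [hf, map_zero, sub_zero] at h
    have : f - (C (eval P (pderiv u f)) * (X u - C (P u)) + C (eval P (pderiv w f)) * (X w - C (P w))) =
        f - C α * yu - C β * yw := by rw [hα, hβ, hyu, hyw]; ring
    rwa [this] at h
  obtain ⟨βi, hβi⟩ : ∃ βi : R, β * βi = 1 := ⟨↑hw.unit⁻¹, hw.mul_val_inv⟩
  have h1 : (C β : MvPolynomial (Fin 2) R) * C βi = 1 := by rw [← C_mul, hβi, C_1]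
  have hid : yu ^ a * yw = C βi * yu ^ a * f - C βi * C α * yu ^ (a + 1) -
      C βi * (yu ^ a * (f - C α * yu - C β * yw)) := by
    linear_combination (-(yu ^ a * yw)) * h1
  rw [hid]
  refine Ideal.sub_mem _ (Ideal.sub_mem _ ?_ ?_) ?_
  · exact Ideal.mem_sup_right (Ideal.mem_sup_left (Ideal.mul_mem_left _ _ (Ideal.mem_span_singleton_self f)))
  · exact Ideal.mem_sup_left (Ideal.mul_mem_left _ _ (Ideal.mem_span_singleton_self _))
  · refine Ideal.mem_sup_right (Ideal.mem_sup_right (Ideal.mul_mem_left _ _ ?_))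
    rw [pow_add]
    exact Ideal.mul_mem_mul (Ideal.pow_mem_pow (X_sub_C_mem_ker_eval P u) a) hr

/-- **Powers of the point ideal modulo the curve**: at a smooth point (`f(P) = 0`, `∂_w f(P)` a
unit, `u ≠ w`), `𝔪_P^j ⊆ ((X_u − P_u)^j) + (f) + 𝔪_P^{j+1}` for every `j` ("therefore `𝔪` is a
principal ideal", generated by the class `ξ` of `X_u − P_u`, in `𝒪_{F,P}`; here modulo `𝔪_P^{j+1}`).
[cite: Kunz2005PlaneAlgebraicCurves, Ch. 6 Regularity Criterion 6.11 (proof of (a) ⇒ (b))] -/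
theorem ker_pow_le_span_pow_sup {u w : Fin 2} (huw : u ≠ w) {P : Fin 2 → R}
    {f : MvPolynomial (Fin 2) R} (hf : eval P f = 0) (hw : IsUnit (eval P (pderiv w f))) (j : ℕ) :
    RingHom.ker (eval P : MvPolynomial (Fin 2) R →+* R) ^ j ≤
      Ideal.span {(X u - C (P u) : MvPolynomial (Fin 2) R) ^ j} ⊔
        (Ideal.span {f} ⊔ RingHom.ker (eval P : MvPolynomial (Fin 2) R →+* R) ^ (j + 1)) := by
  set m := RingHom.ker (eval P : MvPolynomial (Fin 2) R →+* R) with hm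
  induction j with
  | zero => rw [pow_zero, Ideal.one_eq_top, pow_zero, Ideal.span_singleton_one]; exact le_sup_left
  | succ j ih =>
    have hN : (Ideal.span {f} ⊔ m ^ (j + 1)) * m ≤ Ideal.span {f} ⊔ m ^ (j + 1 + 1) := by
      rw [Ideal.sup_mul, ← pow_succ]
      exact sup_le_sup_right Ideal.mul_le_right _
    have hm' : m = Ideal.span {(X u - C (P u) : MvPolynomial (Fin 2) R)} ⊔ Ideal.span {X w - C (P w)} :=
      ker_eval_eq_sup huw P
    have hS : Ideal.span {(X u - C (P u) : MvPolynomial (Fin 2) R) ^ j} * m ≤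
        Ideal.span {(X u - C (P u) : MvPolynomial (Fin 2) R) ^ (j + 1)} ⊔
          (Ideal.span {f} ⊔ m ^ (j + 1 + 1)) := by
      have hprod : Ideal.span {(X u - C (P u) : MvPolynomial (Fin 2) R) ^ j} * m =
          Ideal.span {(X u - C (P u) : MvPolynomial (Fin 2) R) ^ (j + 1)} ⊔
            Ideal.span {(X u - C (P u) : MvPolynomial (Fin 2) R) ^ j * (X w - C (P w))} := by
        rw [hm', Ideal.mul_sup, Ideal.span_singleton_mul_span_singleton,
          Ideal.span_singleton_mul_span_singleton, ← pow_succ]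
      rw [hprod]
      refine sup_le le_sup_left ?_
      rw [Ideal.span_singleton_le_iff_mem]
      exact pow_mul_X_sub_C_mem huw hf hw j
    calc m ^ (j + 1) = m ^ j * m := pow_succ m j
      _ ≤ (Ideal.span {(X u - C (P u) : MvPolynomial (Fin 2) R) ^ j} ⊔ (Ideal.span {f} ⊔ m ^ (j + 1))) * m :=
          Ideal.mul_mono_left ih
      _ ≤ _ := by rw [Ideal.sup_mul]; exact sup_le hS (le_sup_right.trans' hN)

/-- **The quotient `A/((f) + 𝔪_P^k)` is spanned by `1, y_u, …, y_u^{k−1}`** (`y_u = X_u − P_u`) at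
a smooth point: as `R`-modules, `A = Σ_{i<k} R·y_u^i + ((f) + 𝔪_P^k)` (the maximal ideal of the local
ring at a regular point is principal, generated by `ξ`). [cite: Kunz2005PlaneAlgebraicCurves, Ch. 6 Regularity Criterion 6.11 (proof of (a) ⇒ (b))] -/
theorem top_le_span_pow_sup {u w : Fin 2} (huw : u ≠ w) {P : Fin 2 → R}
    {f : MvPolynomial (Fin 2) R} (hf : eval P f = 0) (hw : IsUnit (eval P (pderiv w f))) (k : ℕ) :
    (⊤ : Submodule R (MvPolynomial (Fin 2) R)) ≤
      Submodule.span R (Set.range fun i : Fin k => (X u - C (P u) : MvPolynomial (Fin 2) R) ^ (i : ℕ)) ⊔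
        (Ideal.span {f} ⊔ RingHom.ker (eval P : MvPolynomial (Fin 2) R →+* R) ^ k).restrictScalars R := by
  set m := RingHom.ker (eval P : MvPolynomial (Fin 2) R →+* R) with hm
  set yu : MvPolynomial (Fin 2) R := X u - C (P u) with hyu
  induction k with
  | zero =>
    intro g _
    refine Submodule.mem_sup_right ?_
    rw [Submodule.restrictScalars_mem, pow_zero, Ideal.one_eq_top, sup_top_eq]
    exact Submodule.mem_top
  | succ k ih =>
    intro g _
    obtain ⟨v, hv, n, hn, rfl⟩ := Submodule.mem_sup.1 (ih (Submodule.mem_top (x := g)))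
    rw [Submodule.restrictScalars_mem] at hn
    -- `n ∈ (f) + m^k ⊆ (yu^k) + ((f) + m^(k+1))`
    have hn' : n ∈ Ideal.span {yu ^ k} ⊔ (Ideal.span {f} ⊔ m ^ (k + 1)) := by
      refine (sup_le ?_ (ker_pow_le_span_pow_sup huw hf hw k)) hn
      exact le_sup_right.trans' le_sup_left
    obtain ⟨a, ha, n₁, hn₁, rfl⟩ := Submodule.mem_sup.1 hn'
    obtain ⟨c, rfl⟩ := Ideal.mem_span_singleton'.1 ha
    -- `c yu^k = c(P) • yu^k + (c - c(P)) yu^k`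
    have hsplit : c * yu ^ k = eval P c • yu ^ k + (c - C (eval P c)) * yu ^ k := by
      rw [smul_eq_C_mul]; ring
    have hV : Submodule.span R (Set.range fun i : Fin k => yu ^ (i : ℕ)) ≤
        Submodule.span R (Set.range fun i : Fin (k + 1) => yu ^ (i : ℕ)) := by
      refine Submodule.span_mono ?_
      rintro _ ⟨i, rfl⟩
      exact ⟨Fin.castSucc i, by simp⟩
    rw [hsplit, show v + (eval P c • yu ^ k + (c - C (eval P c)) * yu ^ k + n₁) =
      (v + eval P c • yu ^ k) + ((c - C (eval P c)) * yu ^ k + n₁) by abel]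
    refine Submodule.add_mem _ (Submodule.mem_sup_left (Submodule.add_mem _ (hV hv) ?_))
      (Submodule.mem_sup_right ?_)
    · exact Submodule.smul_mem _ _ (Submodule.subset_span ⟨Fin.last k, by simp⟩)
    · rw [Submodule.restrictScalars_mem]
      refine Ideal.add_mem _ (Ideal.mem_sup_right ?_) hn₁
      rw [pow_succ']
      refine Ideal.mul_mem_mul ?_ (Ideal.pow_mem_pow (X_sub_C_mem_ker_eval P u) k)
      rw [RingHom.mem_ker, map_sub, eval_C, sub_self]

end Jet

section JetField

variable {K : Type*} [Field K]

/-- **Jet bound at a smooth point of a plane curve.** If `f(P) = 0` and `∂_w f(P) ≠ 0` for some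
`w`, then `dim_K K[X₀,X₁]/((f) + 𝔪_P^k) ≤ k`: vanishing to order `≥ k` along the curve at `P` (in
the sense `g ∈ (f) + 𝔪_P^k`) imposes at most `k` linear conditions. The source proves that `𝒪_{F,P}`
is a discrete valuation ring with `𝔪 = (ξ)` at a regular point, whence `dim 𝒪_{F,P}/𝔪^k = k`; we prove
and use only the inequality `≤ k` for the (isomorphic) quotient `K[X,Y]/((f) + 𝔪_P^k)`, together with
its finite-dimensionality. [cite: Kunz2005PlaneAlgebraicCurves, Ch. 6 Regularity Criterion 6.11 (proof of (a) ⇒ (b))] -/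
theorem finrank_quotient_span_sup_pow_le {P : Fin 2 → K} {f : MvPolynomial (Fin 2) K}
    (hf : eval P f = 0) {w : Fin 2} (hw : eval P (pderiv w f) ≠ 0) (k : ℕ) :
    Module.finrank K (MvPolynomial (Fin 2) K ⧸
        (Ideal.span {f} ⊔ RingHom.ker (eval P : MvPolynomial (Fin 2) K →+* K) ^ k)) ≤ k ∧
      Module.Finite K (MvPolynomial (Fin 2) K ⧸
        (Ideal.span {f} ⊔ RingHom.ker (eval P : MvPolynomial (Fin 2) K →+* K) ^ k)) := by
  have huw : w + 1 ≠ w := by fin_cases w <;> decide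
  set J := Ideal.span {f} ⊔ RingHom.ker (eval P : MvPolynomial (Fin 2) K →+* K) ^ k with hJ
  set b : Fin k → MvPolynomial (Fin 2) K ⧸ J :=
    fun i => Ideal.Quotient.mk J ((X (w + 1) - C (P (w + 1))) ^ (i : ℕ)) with hb
  have htop : (⊤ : Submodule K (MvPolynomial (Fin 2) K ⧸ J)) = Submodule.span K (Set.range b) := by
    refine le_antisymm ?_ le_top
    rintro x -
    obtain ⟨g, rfl⟩ := Ideal.Quotient.mk_surjective x
    have hg := top_le_span_pow_sup huw hf (isUnit_iff_ne_zero.2 hw) k (Submodule.mem_top (x := g))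
    obtain ⟨v, hv, n, hn, rfl⟩ := Submodule.mem_sup.1 hg
    rw [Submodule.restrictScalars_mem] at hn
    rw [map_add, Ideal.Quotient.eq_zero_iff_mem.2 hn, add_zero]
    have hmap : Submodule.map ((Ideal.Quotient.mkₐ K J).toLinearMap)
        (Submodule.span K (Set.range fun i : Fin k =>
          (X (w + 1) - C (P (w + 1)) : MvPolynomial (Fin 2) K) ^ (i : ℕ))) =
        Submodule.span K (Set.range b) := by
      rw [Submodule.map_span, ← Set.range_comp]; rfl
    rw [← hmap]
    exact Submodule.mem_map_of_mem hv
  refine ⟨?_, ?_⟩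
  · rw [← finrank_top, htop]
    exact (finrank_range_le_card b).trans (by rw [Fintype.card_fin])
  · rw [Module.finite_def, htop]
    exact Submodule.fg_span (Set.finite_range b)

end JetField

/-! ## The Hilbert-function count -/

section Count

variable (K : Type*) [Field K]

/-- **Stars and bars with a slack variable**: the exponents `n : σ →₀ ℕ` of total degree `≤ s`
number `C(s + |σ|, |σ|)` (bijection `n ↦ (s − |n|, n)` with the exponents on `Option σ` of total
degree exactly `s`, counted by `Finset.card_finsuppAntidiag_nat_eq_choose`) — "the number of monomials
`X_1^{ν_1} ⋯ X_m^{ν_m}` of degree `k`" is `C(m+k−1, m−1)`, here with `m = |σ| + 1`, `k = s`. [cite: Kunz2005PlaneAlgebraicCurves, App. A Example A.10] -/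
theorem nat_card_setOf_sum_le_eq_choose (σ : Type*) [Fintype σ] (s : ℕ) :
    Nat.card {n : σ →₀ ℕ | (n.sum fun _ e => e) ≤ s} =
      (s + Fintype.card σ).choose (Fintype.card σ) := by
  classical
  -- adapted from the tree's Summits/MatrixMultiplication/…/StubMonomialCount (same count)
  have hsum : ∀ m : Option σ →₀ ℕ, (m.sum fun _ e => e) = m none + (m.some.sum fun _ e => e) :=
    fun m => Finsupp.sum_option_index m (fun _ e => e) (fun _ => rfl) (fun _ _ _ => rfl)
  have hmem : ∀ m : Option σ →₀ ℕ,
      m ∈ (Finset.univ : Finset (Option σ)).finsuppAntidiag s ↔ (m.sum fun _ e => e) = s := by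
    intro m
    rw [Finset.mem_finsuppAntidiag']
    exact ⟨fun h => h.1, fun h => ⟨h, Finset.subset_univ _⟩⟩
  let e : {n : σ →₀ ℕ | (n.sum fun _ e => e) ≤ s} ≃
      ↥((Finset.univ : Finset (Option σ)).finsuppAntidiag s) :=
    { toFun := fun n => ⟨n.1.optionElim (s - n.1.sum fun _ e => e), by
        have hn : (n.1.sum fun _ e => e) ≤ s := n.2
        rw [hmem, hsum, Finsupp.optionElim_apply_none, Finsupp.some_optionElim]
        omega⟩
      invFun := fun m => ⟨m.1.some, by
        have h := (hmem m.1).1 m.2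
        rw [hsum] at h
        show (m.1.some.sum fun _ e => e) ≤ s
        omega⟩
      left_inv := fun n => Subtype.ext (by simp only [Finsupp.some_optionElim])
      right_inv := fun m => Subtype.ext (by
        have h := (hmem m.1).1 m.2
        rw [hsum] at h
        have h' : s - (m.1.some.sum fun _ e => e) = m.1 none := by omega
        simp only [h', Finsupp.optionElim_some]) }
  rw [Nat.card_congr e, Nat.card_eq_fintype_card, Fintype.card_coe,
    Finset.card_finsuppAntidiag_nat_eq_choose, Finset.card_univ, Fintype.card_option,
    show Fintype.card σ + 1 + s - 1 = s + Fintype.card σ by omega, Nat.choose_symm_add]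

/-- **`dim_K K[X_σ]_{≤ s} = C(s + |σ|, |σ|)`** (monomial basis `MvPolynomial.basisRestrictSupport`; the
printed count of monomials of degree `s` in `|σ| + 1` variables). [cite: Kunz2005PlaneAlgebraicCurves, App. A Example A.10] -/
theorem finrank_restrictTotalDegree_eq_choose (σ : Type*) [Fintype σ] (s : ℕ) :
    Module.finrank K (restrictTotalDegree σ K s) = (s + Fintype.card σ).choose (Fintype.card σ) :=
  (Module.finrank_eq_nat_card_basis
    (basisRestrictSupport K {n : σ →₀ ℕ | (n.sum fun _ e => e) ≤ s})).trans
    (nat_card_setOf_sum_le_eq_choose σ s)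

/-- `K[X_σ]_{≤ s}` is finite-dimensional (finitely many monomials of degree `≤ s`). [cite: Kunz2005PlaneAlgebraicCurves, App. A Example A.10] -/
theorem finite_restrictTotalDegree (σ : Type*) [Fintype σ] (s : ℕ) :
    Module.Finite K (restrictTotalDegree σ K s) := by
  haveI : Finite {n : σ →₀ ℕ | (n.sum fun _ e => e) ≤ s} := by
    refine Nat.finite_of_card_ne_zero ?_
    rw [nat_card_setOf_sum_le_eq_choose]
    exact (Nat.choose_pos (Nat.le_add_left _ _)).ne'
  exact Module.Finite.of_basis (basisRestrictSupport K {n : σ →₀ ℕ | (n.sum fun _ e => e) ≤ s})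

/-- **`dim_K K[X₀,X₁]_{≤ m} = C(m+2, 2)`** ("`χ_G(k) = C(m+k−1, m−1)`" with three homogeneous variables).
[cite: Kunz2005PlaneAlgebraicCurves, App. A Example A.10] -/
theorem finrank_restrictTotalDegree_fin_two (m : ℕ) :
    Module.finrank K (restrictTotalDegree (Fin 2) K m) = (m + 2).choose 2 := by
  rw [finrank_restrictTotalDegree_eq_choose, Fintype.card_fin]

variable {K}

/-- **Hilbert function of a plane curve, upper bound for the ideal part**: for `f ≠ 0` of degree
`e`, `dim_K (K[X₀,X₁]_{≤m} ∩ (f)) ≤ C(m+2−e, 2)` — a multiple `h·f` of degree `≤ m` has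
`deg h ≤ m − e`. Consequently `dim K[X₀,X₁]_{≤m}/(f)_{≤m} ≥ C(m+2,2) − C(m+2−e,2) = e·m − g + 1`
for `m ≥ e − 2`, `g = (e−1)(e−2)/2` — the affine (degree-filtration) form of the printed injective
multiplication `μ_g : M_{k−d} → M_k` and `χ_{M/gM}(k) = χ_M(k) − χ_M(k−d)` for `M = K[X_1, X_2, X_3]`,
`g = F` homogenised. [cite: Kunz2005PlaneAlgebraicCurves, App. A Lemma A.11 and Example A.12 (a)] -/
theorem finrank_restrictTotalDegree_inf_span_le {f : MvPolynomial (Fin 2) K} (hf : f ≠ 0) (m : ℕ) :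
    Module.finrank K ↥(restrictTotalDegree (Fin 2) K m ⊓ (Ideal.span {f}).restrictScalars K) ≤
      (m + 2 - f.totalDegree).choose 2 := by
  set e := f.totalDegree with he
  by_cases hem : e ≤ m
  · haveI := finite_restrictTotalDegree K (Fin 2) (m - e)
    have hle : restrictTotalDegree (Fin 2) K m ⊓ (Ideal.span {f}).restrictScalars K ≤
        (restrictTotalDegree (Fin 2) K (m - e)).map (LinearMap.mulLeft K f) := by
      intro g hg
      obtain ⟨hgm, hgf⟩ := Submodule.mem_inf.1 hg
      rw [Submodule.restrictScalars_mem, Ideal.mem_span_singleton'] at hgf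
      obtain ⟨a, rfl⟩ := hgf
      refine ⟨a, ?_, by rw [LinearMap.mulLeft_apply, mul_comm]⟩
      simp only [SetLike.mem_coe, mem_restrictTotalDegree] at hgm ⊢
      by_cases ha : a = 0
      · rw [ha, totalDegree_zero]; exact Nat.zero_le _
      · rw [totalDegree_mul_of_isDomain ha hf] at hgm
        omega
    calc Module.finrank K ↥(restrictTotalDegree (Fin 2) K m ⊓ (Ideal.span {f}).restrictScalars K)
        ≤ Module.finrank K ↥((restrictTotalDegree (Fin 2) K (m - e)).map (LinearMap.mulLeft K f)) :=
          Submodule.finrank_mono hle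
      _ ≤ Module.finrank K ↥(restrictTotalDegree (Fin 2) K (m - e)) := Submodule.finrank_map_le _ _
      _ = (m + 2 - e).choose 2 := by
          rw [finrank_restrictTotalDegree_fin_two, show m - e + 2 = m + 2 - e by omega]
  · have hbot : restrictTotalDegree (Fin 2) K m ⊓ (Ideal.span {f}).restrictScalars K = ⊥ := by
      rw [eq_bot_iff]
      intro g hg
      obtain ⟨hgm, hgf⟩ := Submodule.mem_inf.1 hg
      rw [Submodule.restrictScalars_mem, Ideal.mem_span_singleton'] at hgf
      obtain ⟨a, rfl⟩ := hgf
      rw [mem_restrictTotalDegree] at hgm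
      rw [Submodule.mem_bot]
      by_contra hne
      have ha : a ≠ 0 := fun h => hne (by rw [h, zero_mul])
      rw [totalDegree_mul_of_isDomain ha hf] at hgm
      omega
    rw [hbot, finrank_bot]
    exact Nat.zero_le _

end Count

/-! ## Existence of sections of degree `≤ m` vanishing to order `k` at the points of `Δ` -/

section Existence

variable {K : Type*} [Field K]

/-- **Existence of the auxiliary polynomial.** Let `f ∈ K[X₀,X₁]` have degree `e`, let `Δ` be a
finite set of smooth `K`-points of the curve `f = 0` (at each `P ∈ Δ`: `f(P) = 0` and some partial
derivative of `f` does not vanish), and let `k·|Δ| + C(m+2−e, 2) < C(m+2, 2)`. Then there is a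
polynomial `g` of degree `≤ m`, NOT divisible by `f` (so `g ≠ 0` on the curve), with
`g ∈ (f) + 𝔪_P^k` ("`g` vanishes to order `≥ k` along the curve") at every `P ∈ Δ`. The count:
`dim K[X]_{≤m} = C(m+2,2)` (`finrank_restrictTotalDegree_fin_two`), at most `k` conditions per
point (`finrank_quotient_span_sup_pow_le`), and the excluded multiples of `f` have dimension
`≤ C(m+2−e,2)` (`finrank_restrictTotalDegree_inf_span_le`); rank–nullity. Our corollary formulation
(the "auxiliary polynomial" parameter count), not a numbered statement of the source. [cite: Kunz2005PlaneAlgebraicCurves, App. A Lemma A.11 with Ch. 6 Criterion 6.11 (corollary; parameter count)] -/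
theorem exists_totalDegree_le_notMem_span (f : MvPolynomial (Fin 2) K) (Δ : Finset (Fin 2 → K))
    (k m : ℕ) (hΔ : ∀ P ∈ Δ, eval P f = 0 ∧ ∃ w, eval P (pderiv w f) ≠ 0)
    (hcount : k * Δ.card + (m + 2 - f.totalDegree).choose 2 < (m + 2).choose 2) :
    ∃ g : MvPolynomial (Fin 2) K, g.totalDegree ≤ m ∧ g ∉ Ideal.span {f} ∧
      ∀ P ∈ Δ, g ∈ Ideal.span {f} ⊔ RingHom.ker (eval P : MvPolynomial (Fin 2) K →+* K) ^ k := by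
  classical
  have hf0 : f ≠ 0 := by
    rintro rfl
    rw [totalDegree_zero, Nat.sub_zero] at hcount
    omega
  set V := restrictTotalDegree (Fin 2) K m with hV
  haveI : Module.Finite K V := finite_restrictTotalDegree K (Fin 2) m
  set J : ↥Δ → Ideal (MvPolynomial (Fin 2) K) :=
    fun P => Ideal.span {f} ⊔ RingHom.ker (eval (P : Fin 2 → K) : MvPolynomial (Fin 2) K →+* K) ^ k
    with hJ
  have hJP : ∀ P : ↥Δ, Module.finrank K (MvPolynomial (Fin 2) K ⧸ J P) ≤ k ∧
      Module.Finite K (MvPolynomial (Fin 2) K ⧸ J P) := fun P => by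
    obtain ⟨hfP, w, hw⟩ := hΔ P P.2
    exact finrank_quotient_span_sup_pow_le hfP hw k
  haveI : ∀ P : ↥Δ, Module.Finite K (MvPolynomial (Fin 2) K ⧸ J P) := fun P => (hJP P).2
  set L : V →ₗ[K] (∀ P : ↥Δ, MvPolynomial (Fin 2) K ⧸ J P) :=
    LinearMap.pi fun P => (Ideal.Quotient.mkₐ K (J P)).toLinearMap ∘ₗ V.subtype with hL
  -- dimension of the target
  have htarget : Module.finrank K (∀ P : ↥Δ, MvPolynomial (Fin 2) K ⧸ J P) ≤ k * Δ.card := by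
    rw [Module.finrank_pi_fintype]
    calc ∑ P : ↥Δ, Module.finrank K (MvPolynomial (Fin 2) K ⧸ J P) ≤ ∑ _P : ↥Δ, k :=
          Finset.sum_le_sum fun P _ => (hJP P).1
      _ = k * Δ.card := by rw [Finset.sum_const, Finset.card_univ, Fintype.card_coe, smul_eq_mul,
          mul_comm]
  have hrange : Module.finrank K ↥(LinearMap.range L) ≤ k * Δ.card :=
    (Submodule.finrank_le _).trans htarget
  have hrank := LinearMap.finrank_range_add_finrank_ker L
  have hVdim : Module.finrank K V = (m + 2).choose 2 := finrank_restrictTotalDegree_fin_two K m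
  -- some element of the kernel is not a multiple of `f`
  have hker : ∃ g ∈ LinearMap.ker L, (g : MvPolynomial (Fin 2) K) ∉ Ideal.span {f} := by
    by_contra hcon
    push Not at hcon
    have hle : LinearMap.ker L ≤ Submodule.comap V.subtype ((Ideal.span {f}).restrictScalars K) :=
      fun g hg => hcon g hg
    have h1 : Module.finrank K ↥(LinearMap.ker L) ≤ (m + 2 - f.totalDegree).choose 2 := by
      refine (Submodule.finrank_mono hle).trans ?_
      rw [← Submodule.finrank_map_subtype_eq, Submodule.map_comap_subtype]
      exact finrank_restrictTotalDegree_inf_span_le hf0 m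
    omega
  obtain ⟨g, hgker, hgf⟩ := hker
  refine ⟨g, (mem_restrictTotalDegree _ _ _).1 g.2, hgf, fun P hP => ?_⟩
  have h := congr_fun (LinearMap.mem_ker.1 hgker) ⟨P, hP⟩
  simpa [hL, Ideal.Quotient.mkₐ_eq_mk, Ideal.Quotient.eq_zero_iff_mem] using h

/-- The same existence statement with the point ideals written as `⟨X₀ − P₀, X₁ − P₁⟩^k` (the form
consumed by the good-prime valuation inequality of `PlaneCurveLocalisation.lean`). [cite: Kunz2005PlaneAlgebraicCurves, App. A Lemma A.11 with Ch. 6 Criterion 6.11 (corollary; parameter count)] -/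
theorem exists_totalDegree_le_notMem_span' (f : MvPolynomial (Fin 2) K) (Δ : Finset (Fin 2 → K))
    (k m : ℕ) (hΔ : ∀ P ∈ Δ, eval P f = 0 ∧ ∃ w, eval P (pderiv w f) ≠ 0)
    (hcount : k * Δ.card + (m + 2 - f.totalDegree).choose 2 < (m + 2).choose 2) :
    ∃ g : MvPolynomial (Fin 2) K, g.totalDegree ≤ m ∧ g ∉ Ideal.span {f} ∧
      ∀ P ∈ Δ, g ∈ Ideal.span {f} ⊔
        Ideal.span (Set.range fun i : Fin 2 => (X i - C (P i) : MvPolynomial (Fin 2) K)) ^ k := by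
  obtain ⟨g, h1, h2, h3⟩ := exists_totalDegree_le_notMem_span f Δ k m hΔ hcount
  exact ⟨g, h1, h2, fun P hP => by rw [← ker_eval_eq_span]; exact h3 P hP⟩

end Existence

end Literature.NumberTheory.DiophantineGeometry.PlaneCurve
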